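import Literature.AlgebraicGeometry.HodgeTheory.SmoothHypersurfaceAtlas
import HarnessLib

/-!
# The affine atlas of `ℂℙⁿ` is positive; the two affine charts of `ℂℙ¹`

Topic `Literature/Topology/FourManifolds`, a sequel to `…ComplexProjectiveSpace` /
`…ComplexProjectiveSpaceOrientationProofs` (a brick for the proof of the named fact
`Literature.Geometry.Symplectic.jSphere_wedgeCount_factorsThroughHomology`, where classes of
two-chart spheres `ℂℙ¹ → X` are localised at their crossings with a `J`-curve and the local
orientation classes of `ℂℙ¹` must be read in the affine charts).  Everything here is **proved**;
no definition, no named fact.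

* `ComplexProjectiveSpace.isPositiveAtlas` — **the affine atlas of `ℂℙⁿ` is a positive atlas**
  in the sense of `Literature.AlgebraicTopology.SingularHomology.IsPositiveAtlas` (every change of
  affine charts is differentiable with Jacobian of positive determinant): the transition maps are
  the rational maps `transitionComplex i k`, complex-differentiable on the overlaps, so the general
  criterion `isPositiveAtlas_of_differentiable_complex` (Milnor–Stasheff §13 p. 151: holomorphic
  atlases are oriented, `det_ℝ = |det_ℂ|² > 0`) applies.  Hence
  `positiveAtlasOrientation (isPositiveAtlas n) g` is the complex homological `ℤ`-orientation of
  `ℂℙⁿ`, with local classes computable in every affine chart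
  (`positiveAtlasOrientation_localClass_symm_restrOpen`).
* The two affine charts of the Riemann sphere `ℂℙ¹` (Griffiths–Harris, Ch. 0 §2): with the
  identification `z ↦ realCoordinates 1 (fun _ => z)` of `ℂ` with the model `ℝ²`,
  `affineChart i p = realCoordinates 1 (fun _ => affineCoordComplex i p 0)`
  (`affineChart_apply_eq`), the chart inverses are `z ↦ [1 : z]` and `w ↦ [w : 1]`
  (`affineCoordComplex_affineChart_symm`), the second coordinate is the inverse of the first
  (`affineCoordComplex_one_eq_inv`), and the only point outside the first chart is `∞ = [0 : 1]`
  (`eq_affineChart_one_symm_of_not_coordNeZero`, `coordNeZero_one_of_not_coordNeZero_zero`).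

## References

* J. Milnor, J. Stasheff, *Characteristic Classes*, PUP 1974, §13 p. 151, §14. [MilnorStasheff1974]
* P. Griffiths, J. Harris, *Principles of Algebraic Geometry* (1978), Ch. 0 §2. [GriffithsHarrisPrinciples1978]
-/

noncomputable section

open Set Function
open Literature.AlgebraicTopology.SingularHomology Literature.AlgebraicGeometry.HodgeTheory

namespace Literature.Topology.FourManifolds

namespace ComplexProjectiveSpace

variable {n : ℕ}

/-! ### The affine atlas is positive -/

/-- **The affine atlas of `ℂℙⁿ` is positive** (Milnor–Stasheff 1974, §13 p. 151: the charts of a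
complex manifold form an oriented atlas, since the real Jacobian of a holomorphic change of
coordinates is `|det_ℂ|² > 0`; here via the tree's criterion
`isPositiveAtlas_of_differentiable_complex`, the changes of affine charts being the
complex-differentiable rational maps `transitionComplex i k`). [cite: MilnorStasheff1974, §13 p. 151] -/
theorem isPositiveAtlas (n : ℕ) : IsPositiveAtlas (2 * n) (ComplexProjectiveSpace n) := by
  apply isPositiveAtlas_of_differentiable_complex
  rintro c ⟨k, rfl⟩ c' ⟨i, rfl⟩ y hy
  set R := realCoordinates n with hR
  -- the map read in `ℂⁿ` is `transitionComplex i k`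
  have hfun : (fun v : Fin n → ℂ => R.symm (affineChart k ((affineChart i).symm (R v)))) =
      transitionComplex i k := by
    funext v
    change R.symm (((affineChart k : ComplexProjectiveSpace n → EuclideanSpace ℝ (Fin (2 * n))) ∘
      (affineChart i).symm) (R v)) = _
    rw [affineChart_comp_symm]
    simp [hR]
  rw [hfun]
  -- which is complex-differentiable at `R⁻¹ (affineChart i y)`, a point of the overlap
  have h1 : (affineChart i).symm (affineChart i y) = y := (affineChart i).left_inv hy.2
  have h2 : CoordNeZero k y := hy.1
  rw [← h1, affineChart_symm_apply, coordNeZero_mk] at h2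
  exact ((contDiffOn_transitionComplex i k).differentiableOn (by simp)).differentiableAt
    ((isOpen_setOf_homogenize_apply_ne_zero i k).mem_nhds h2)

/-! ### The two affine charts of `ℂℙ¹` -/

/-- A vector of `ℂ¹` is the constant vector on its only entry. [folklore] -/
theorem eq_const_of_fin_one (w : Fin 1 → ℂ) : w = fun _ => w 0 := by
  funext j
  rw [Subsingleton.elim j 0]

/-- The affine charts of `ℂℙ¹` read through `z ↦ realCoordinates 1 (fun _ => z)`:
`affineChart i p = realCoordinates 1 (fun _ => affineCoordComplex i p 0)`. [cite: GriffithsHarrisPrinciples1978, Ch. 0 §2] -/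
theorem affineChart_apply_eq (i : Fin (1 + 1)) (p : ComplexProjectiveSpace 1) :
    affineChart i p = realCoordinates 1 (fun _ : Fin 1 => affineCoordComplex i p 0) := by
  rw [affineChart_apply, affineCoord, comp_apply, ← eq_const_of_fin_one]

/-- The inverse affine charts of `ℂℙ¹`: the affine coordinate of `(affineChart i)⁻¹ (z)` is `z`
(`[1 : z] ↦ z`, `[w : 1] ↦ w`). [cite: GriffithsHarrisPrinciples1978, Ch. 0 §2] -/
theorem affineCoordComplex_affineChart_symm (i : Fin (1 + 1)) (z : ℂ) :
    affineCoordComplex i ((affineChart i).symm (realCoordinates 1 (fun _ : Fin 1 => z))) 0 = z := by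
  rw [affineChart_symm_apply, affineCoordComplex_mk, ContinuousLinearEquiv.symm_apply_apply]
  simp [homogenize, Fin.insertNth_apply_same, Fin.insertNth_apply_succAbove]

/-- A point of an inverse affine chart lies in the chart domain. [folklore] -/
theorem coordNeZero_affineChart_symm (i : Fin (n + 1)) (w : EuclideanSpace ℝ (Fin (2 * n))) :
    CoordNeZero i ((affineChart i).symm w) :=
  (affineChart i).map_target (mem_univ w)

/-- A point of `ℂℙ¹` in the domain of the affine chart `i` is the inverse chart of its affine
coordinate. [cite: GriffithsHarrisPrinciples1978, Ch. 0 §2] -/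
theorem affineChart_symm_affineCoordComplex {i : Fin (1 + 1)} {p : ComplexProjectiveSpace 1}
    (hp : CoordNeZero i p) :
    (affineChart i).symm (realCoordinates 1 (fun _ : Fin 1 => affineCoordComplex i p 0)) = p := by
  rw [← affineChart_apply_eq]
  exact (affineChart i).left_inv hp

/-- On `ℂℙ¹`, a point outside the chart `{v₀ ≠ 0}` lies in the chart `{v₁ ≠ 0}`. [folklore] -/
theorem coordNeZero_one_of_not_coordNeZero_zero {p : ComplexProjectiveSpace 1} (hp : ¬ CoordNeZero 0 p) :
    CoordNeZero 1 p := by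
  obtain ⟨i, hi⟩ := exists_coordNeZero p
  rcases Fin.eq_zero_or_eq_succ i with rfl | ⟨j, rfl⟩
  · exact absurd hi hp
  · rwa [Subsingleton.elim j 0] at hi

/-- On `ℂℙ¹`, the second affine coordinate is the inverse of the first: `v₀ / v₁ = (v₁ / v₀)⁻¹`
(with the junk values `x / 0 = 0`, `0⁻¹ = 0` this holds at every point). [cite: GriffithsHarrisPrinciples1978, Ch. 0 §2] -/
theorem affineCoordComplex_one_eq_inv (p : ComplexProjectiveSpace 1) :
    affineCoordComplex 1 p 0 = (affineCoordComplex 0 p 0)⁻¹ := by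
  induction p using ind with
  | h v =>
    simp only [affineCoordComplex_mk, inv_div]
    rfl

/-- On `ℂℙ¹`, a point outside the chart `{v₀ ≠ 0}` has second affine coordinate `0`. [folklore] -/
theorem affineCoordComplex_one_eq_zero {p : ComplexProjectiveSpace 1} (hp : ¬ CoordNeZero 0 p) :
    affineCoordComplex 1 p 0 = 0 := by
  induction p using ind with
  | h v =>
    have h0 : (v : Fin (1 + 1) → ℂ) 0 = 0 := by
      by_contra h
      exact hp ((coordNeZero_mk 0 v).2 h)
    simp only [affineCoordComplex_mk]
    change (v : Fin (1 + 1) → ℂ) ((1 : Fin (1 + 1)).succAbove 0) / (v : Fin (1 + 1) → ℂ) 1 = 0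
    rw [show (1 : Fin (1 + 1)).succAbove 0 = 0 from rfl, h0, zero_div]

/-- On `ℂℙ¹`, the only point outside the chart `{v₀ ≠ 0}` is `∞ = [0 : 1] = (affineChart 1)⁻¹ 0`.
[cite: GriffithsHarrisPrinciples1978, Ch. 0 §2] -/
theorem eq_affineChart_one_symm_of_not_coordNeZero {p : ComplexProjectiveSpace 1} (hp : ¬ CoordNeZero 0 p) :
    p = (affineChart 1).symm (realCoordinates 1 (fun _ : Fin 1 => (0 : ℂ))) := by
  rw [← affineCoordComplex_one_eq_zero hp]
  exact (affineChart_symm_affineCoordComplex (coordNeZero_one_of_not_coordNeZero_zero hp)).symm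

/-- The point `∞ = (affineChart 1)⁻¹ 0` of `ℂℙ¹` is not in the chart `{v₀ ≠ 0}`. [folklore] -/
theorem not_coordNeZero_zero_affineChart_one_symm :
    ¬ CoordNeZero 0 ((affineChart (n := 1) 1).symm (realCoordinates 1 (fun _ : Fin 1 => (0 : ℂ)))) := by
  rw [affineChart_symm_apply, coordNeZero_mk, ContinuousLinearEquiv.symm_apply_apply]
  simp [homogenize]
  rfl

end ComplexProjectiveSpace

end Literature.Topology.FourManifolds

end
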